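import Summits.PneNP.PneNP.Theorems.PhaseTwinsPolyDepthTwinsAboveDefs

/-!
# Route PhaseTwins, crux `PolyDepthTwinsAbove` (stmt-PneNP-2719), line `parity-wired-ports`:
# generic bookkeeping for `stub_connector` (fibres of configurations, Bernoulli product weights)

Support for Sly's Lemma 2.2 for the parity wiring (`stub_connector`). Two generic tools, stated without
auxiliary definitions (fibres and weights are written out):

* FIBRES. A configuration `t : Finset (K × L)` is the same as its family of fibres
  `k ↦ {l | (k, l) ∈ t}`; sums over configurations are sums over families (`sum_eq_sum_fib`), sizes add
  up (`card_eq_sum_card_fib`), and products over `t` are products over the fibres (`prod_mem_eq_prod_prod_fib`,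
  `prod_mem_eq_prod_pow_fib`, `fib_compl`).
* BERNOULLI PRODUCT WEIGHTS `Π_{c ∈ t} p c · Π_{c ∉ t} (1 - p c)` (the shape of the tree's
  `SlyReduction.sum_bernoulliWeight*`): transport along an equivalence of coordinates (`sum_bw_equiv`),
  splitting over a sum of coordinate types (`bw_sum_split`, `sum_bw_sum_left`) and over a product
  (`bw_eq_prod_fib`, `sum_bw_prod_split`), marginalisation onto the coordinates in the range of an
  injection (`sum_bw_marginal`), and the vacancy marginal (`sum_bw_disjoint`).

All statements are elementary finite combinatorics. [folklore]
-/

noncomputable section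

open scoped BigOperators

namespace Summit.PneNP.PneNP.Cruxes.PolyDepthTwinsAbove.ParityWiredPorts

open Finset
open Literature.Computability.Complexity (SlyReduction.sum_bernoulliWeight)

set_option linter.dupNamespace false

/-! ## Fibres of a configuration of `K × L` -/

section Fibres

variable {K L : Type*} [DecidableEq K] [DecidableEq L]

/-- **Sums over configurations are sums over families of fibres.** -/
theorem sum_eq_sum_fib [Fintype K] [Fintype L] {β : Type*} [AddCommMonoid β] (Φ : (K → Finset L) → β) :
    ∑ t : Finset (K × L), Φ (fun k => univ.filter fun l => (k, l) ∈ t) = ∑ S : K → Finset L, Φ S := by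
  refine Fintype.sum_equiv ⟨fun t k => univ.filter fun l => (k, l) ∈ t,
    fun S => univ.filter fun x => x.2 ∈ S x.1, ?_, ?_⟩ _ _ fun t => rfl
  · intro t
    ext x
    simp
  · intro S
    funext k
    ext l
    simp

/-- The points of `t` over `k` are the fibre over `k`, placed in the slice `{k} × L`. -/
theorem filter_fst_eq [Fintype L] (t : Finset (K × L)) (k : K) :
    t.filter (fun y => y.1 = k) = (univ.filter fun l => (k, l) ∈ t).map (Function.Embedding.sectR k L) := by
  ext ⟨k', l⟩
  rw [mem_filter, mem_map]
  simp only [Function.Embedding.sectR_apply, Prod.mk.injEq, mem_filter, mem_univ, true_and]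
  constructor
  · rintro ⟨h, rfl⟩
    exact ⟨l, h, rfl, rfl⟩
  · rintro ⟨l', h, rfl, rfl⟩
    exact ⟨h, rfl⟩

/-- The size of a configuration is the sum of the sizes of its fibres. -/
theorem card_eq_sum_card_fib [Fintype K] [Fintype L] (t : Finset (K × L)) :
    t.card = ∑ k, (univ.filter fun l => (k, l) ∈ t).card := by
  rw [card_eq_sum_card_fiberwise (f := Prod.fst) (s := t) (t := univ) fun _ _ => mem_coe.2 (mem_univ _)]
  refine sum_congr rfl fun k _ => ?_
  rw [filter_fst_eq, card_map]

/-- A product over a configuration of a weight depending only on the first coordinate. -/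
theorem prod_mem_eq_prod_pow_fib [Fintype K] [Fintype L] (t : Finset (K × L)) (a : K → ℝ) :
    ∏ x ∈ t, a x.1 = ∏ k, a k ^ (univ.filter fun l => (k, l) ∈ t).card := by
  rw [← prod_fiberwise' t Prod.fst a]
  refine prod_congr rfl fun k _ => ?_
  rw [prod_const, filter_fst_eq, card_map]

/-- A product over a configuration, fibre by fibre. -/
theorem prod_mem_eq_prod_prod_fib [Fintype K] [Fintype L] (t : Finset (K × L)) (f : K × L → ℝ) :
    ∏ x ∈ t, f x = ∏ k, ∏ l ∈ univ.filter (fun l => (k, l) ∈ t), f (k, l) := by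
  rw [← prod_fiberwise t Prod.fst f]
  refine prod_congr rfl fun k _ => ?_
  rw [filter_fst_eq, prod_map]
  rfl

/-- Fibres of the complement are the complements of the fibres. -/
theorem fib_compl [Fintype K] [Fintype L] (t : Finset (K × L)) (k : K) :
    (univ.filter fun l => (k, l) ∈ tᶜ) = (univ.filter fun l => (k, l) ∈ t)ᶜ := by
  ext l
  simp

end Fibres

/-! ## Bernoulli product weights `Π_{c ∈ t} p c · Π_{c ∉ t} (1 - p c)` -/

section Bernoulli

variable {C : Type*} [Fintype C] [DecidableEq C]

/-- The weights are nonnegative for `p ∈ [0, 1]`. -/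
theorem bw_nonneg {p : C → ℝ} (hp0 : ∀ c, 0 ≤ p c) (hp1 : ∀ c, p c ≤ 1) (t : Finset C) :
    0 ≤ (∏ c ∈ t, p c) * ∏ c ∈ tᶜ, (1 - p c) :=
  mul_nonneg (prod_nonneg fun c _ => hp0 c) (prod_nonneg fun c _ => sub_nonneg.2 (hp1 c))

/-- Transport of the weight along an equivalence of coordinates. -/
theorem bw_map_equiv {C' : Type*} [Fintype C'] [DecidableEq C'] (f : C ≃ C') (p : C → ℝ) (t : Finset C) :
    (∏ c ∈ t.map f.toEmbedding, p (f.symm c)) * ∏ c ∈ (t.map f.toEmbedding)ᶜ, (1 - p (f.symm c)) =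
      (∏ c ∈ t, p c) * ∏ c ∈ tᶜ, (1 - p c) := by
  have hc : (t.map f.toEmbedding)ᶜ = tᶜ.map f.toEmbedding := by
    ext y
    simp only [mem_compl, mem_map_equiv]
  rw [hc, prod_map, prod_map]
  simp

/-- **Transport of Bernoulli sums along an equivalence of coordinates.** -/
theorem sum_bw_equiv {C' : Type*} [Fintype C'] [DecidableEq C'] (f : C ≃ C') (p : C → ℝ)
    (F : Finset C → ℝ) :
    ∑ t : Finset C, ((∏ c ∈ t, p c) * ∏ c ∈ tᶜ, (1 - p c)) * F t =
      ∑ t' : Finset C', ((∏ c ∈ t', p (f.symm c)) * ∏ c ∈ t'ᶜ, (1 - p (f.symm c))) *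
        F (t'.map f.symm.toEmbedding) := by
  refine Fintype.sum_equiv (Equiv.finsetCongr f) _ _ fun t => ?_
  rw [Equiv.finsetCongr_apply, bw_map_equiv, Finset.map_map]
  have : f.toEmbedding.trans f.symm.toEmbedding = Function.Embedding.refl C := by
    ext x; simp
  rw [this, Finset.map_refl]

/-- Over a sum of coordinate types the weight is the product of the weights of the two traces. -/
theorem bw_sum_split {C₁ C₂ : Type*} [Fintype C₁] [Fintype C₂] [DecidableEq C₁] [DecidableEq C₂]
    (p : C₁ ⊕ C₂ → ℝ) (t : Finset (C₁ ⊕ C₂)) :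
    (∏ c ∈ t, p c) * ∏ c ∈ tᶜ, (1 - p c) =
      ((∏ c ∈ t.toLeft, p (Sum.inl c)) * ∏ c ∈ t.toLeftᶜ, (1 - p (Sum.inl c))) *
        ((∏ c ∈ t.toRight, p (Sum.inr c)) * ∏ c ∈ t.toRightᶜ, (1 - p (Sum.inr c))) := by
  have h1 : ∏ c ∈ t, p c = (∏ c ∈ t.toLeft, p (Sum.inl c)) * ∏ c ∈ t.toRight, p (Sum.inr c) := by
    conv_lhs => rw [← toLeft_disjSum_toRight (u := t)]
    rw [prod_disjSum]
  have hc : tᶜ = (t.toLeft)ᶜ.disjSum (t.toRight)ᶜ := by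
    ext c
    rcases c with c | c <;> simp
  have h2 : ∏ c ∈ tᶜ, (1 - p c) =
      (∏ c ∈ (t.toLeft)ᶜ, (1 - p (Sum.inl c))) * ∏ c ∈ (t.toRight)ᶜ, (1 - p (Sum.inr c)) := by
    rw [hc, prod_disjSum]
  rw [h1, h2]
  ring

/-- **Over a sum of coordinate types, an integrand reading only the first summand**: the second
summand integrates out. -/
theorem sum_bw_sum_left {C₁ C₂ : Type*} [Fintype C₁] [Fintype C₂] [DecidableEq C₁] [DecidableEq C₂]
    (p : C₁ ⊕ C₂ → ℝ) (G : Finset C₁ → ℝ) :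
    ∑ t : Finset (C₁ ⊕ C₂), ((∏ c ∈ t, p c) * ∏ c ∈ tᶜ, (1 - p c)) * G t.toLeft =
      ∑ t₁ : Finset C₁, ((∏ c ∈ t₁, p (Sum.inl c)) * ∏ c ∈ t₁ᶜ, (1 - p (Sum.inl c))) * G t₁ := by
  have hsplit : ∑ t : Finset (C₁ ⊕ C₂), ((∏ c ∈ t, p c) * ∏ c ∈ tᶜ, (1 - p c)) * G t.toLeft =
      ∑ t₁ : Finset C₁, ∑ t₂ : Finset C₂,
        ((∏ c ∈ t₁, p (Sum.inl c)) * ∏ c ∈ t₁ᶜ, (1 - p (Sum.inl c))) *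
          ((∏ c ∈ t₂, p (Sum.inr c)) * ∏ c ∈ t₂ᶜ, (1 - p (Sum.inr c))) * G t₁ := by
    rw [← Fintype.sum_prod_type']
    refine Fintype.sum_equiv Finset.sumEquiv.toEquiv _ _ fun t => ?_
    simp only [RelIso.coe_fn_toEquiv, Finset.sumEquiv_apply_fst, Finset.sumEquiv_apply_snd]
    rw [bw_sum_split]
  rw [hsplit]
  refine sum_congr rfl fun t₁ _ => ?_
  rw [← sum_mul, ← mul_sum, SlyReduction.sum_bernoulliWeight (fun c => p (Sum.inr c)), mul_one]

/-- Over a product of coordinate types the weight is the product of the weights of the fibres. -/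
theorem bw_eq_prod_fib {K L : Type*} [Fintype K] [Fintype L] [DecidableEq K] [DecidableEq L]
    (p : K × L → ℝ) (t : Finset (K × L)) :
    (∏ c ∈ t, p c) * ∏ c ∈ tᶜ, (1 - p c) =
      ∏ k, ((∏ l ∈ univ.filter (fun l => (k, l) ∈ t), p (k, l)) *
        ∏ l ∈ (univ.filter fun l => (k, l) ∈ t)ᶜ, (1 - p (k, l))) := by
  rw [prod_mul_distrib, prod_mem_eq_prod_prod_fib t p, prod_mem_eq_prod_prod_fib tᶜ fun y => 1 - p y]
  congr 1
  refine prod_congr rfl fun k _ => ?_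
  rw [fib_compl]

/-- **Splitting a Bernoulli sum of a product integrand over a product of coordinate types.** -/
theorem sum_bw_prod_split {K L : Type*} [Fintype K] [Fintype L] [DecidableEq K] [DecidableEq L]
    (p : K × L → ℝ) (G : K → Finset L → ℝ) :
    ∑ t : Finset (K × L), ((∏ c ∈ t, p c) * ∏ c ∈ tᶜ, (1 - p c)) *
        ∏ k, G k (univ.filter fun l => (k, l) ∈ t) =
      ∏ k, ∑ s : Finset L, ((∏ l ∈ s, p (k, l)) * ∏ l ∈ sᶜ, (1 - p (k, l))) * G k s := by
  rw [Fintype.prod_sum]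
  rw [← sum_eq_sum_fib (fun S : K → Finset L =>
    ∏ k, ((∏ l ∈ S k, p (k, l)) * ∏ l ∈ (S k)ᶜ, (1 - p (k, l))) * G k (S k))]
  refine sum_congr rfl fun t _ => ?_
  rw [bw_eq_prod_fib, ← prod_mul_distrib]

/-- **Marginalisation.** A Bernoulli sum of an integrand that reads only the coordinates in the range
of an injection `κ : U → C` is the Bernoulli sum over `U` with the pulled-back probabilities. -/
theorem sum_bw_marginal {U : Type*} [Fintype U] [DecidableEq U] (κ : U → C) (hκ : Function.Injective κ)
    (p : C → ℝ) (G : Finset U → ℝ) :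
    ∑ t : Finset C, ((∏ c ∈ t, p c) * ∏ c ∈ tᶜ, (1 - p c)) * G (univ.filter fun u => κ u ∈ t) =
      ∑ τ : Finset U, ((∏ u ∈ τ, p (κ u)) * ∏ u ∈ τᶜ, (1 - p (κ u))) * G τ := by
  classical
  -- coordinates: `U ⊕ U' ≃ C`, `U'` the complement of the range
  let f : U ⊕ {c // c ∉ Set.range κ} ≃ C :=
    (Equiv.sumCongr (Equiv.ofInjective κ hκ) (Equiv.refl _)).trans
      (Equiv.sumCompl fun c => c ∈ Set.range κ)
  have hfl : ∀ u, f (Sum.inl u) = κ u := fun u => rfl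
  rw [sum_bw_equiv f.symm]
  simp only [Equiv.symm_symm]
  have hG : ∀ t' : Finset (U ⊕ {c // c ∉ Set.range κ}),
      G (univ.filter fun u => κ u ∈ t'.map f.toEmbedding) = G t'.toLeft := by
    intro t'
    congr 1
    ext u
    simp only [mem_filter, mem_univ, true_and, mem_toLeft, mem_map_equiv]
    rw [← hfl u, Equiv.symm_apply_apply]
  simp_rw [hG]
  rw [sum_bw_sum_left]
  rfl

/-- **Vacancy marginal**: the probability that all coordinates of `D` are vacant is `Π_{c ∈ D} (1 - p c)`. -/
theorem sum_bw_disjoint (p : C → ℝ) (D : Finset C) :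
    ∑ t : Finset C, ((∏ c ∈ t, p c) * ∏ c ∈ tᶜ, (1 - p c)) * (if Disjoint D t then 1 else 0) =
      ∏ c ∈ D, (1 - p c) := by
  -- marginal of the complementary probabilities, through `t ↦ tᶜ`
  have key : ∑ t : Finset C, ((∏ c ∈ t, (1 - p c)) * ∏ c ∈ tᶜ, (1 - (1 - p c))) *
      (if D ⊆ t then 1 else 0) = ∏ c ∈ D, (1 - p c) := by
    have h := Finset.prod_add (fun c => 1 - p c) (fun c => if c ∈ D then 0 else p c) (univ : Finset C)
    have hl : ∏ c, ((1 - p c) + if c ∈ D then 0 else p c) = ∏ c ∈ D, (1 - p c) := by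
      rw [← prod_mul_prod_compl D]
      rw [prod_congr rfl fun c (hc : c ∈ D) => by rw [if_pos hc, add_zero],
        prod_congr rfl fun c (hc : c ∈ Dᶜ) => by rw [if_neg (mem_compl.1 hc), sub_add_cancel]]
      rw [prod_const_one, mul_one]
    rw [hl] at h
    rw [h, ← Finset.powerset_univ]
    refine (sum_congr rfl fun t _ => ?_).symm
    rw [Finset.compl_eq_univ_sdiff]
    simp only [sub_sub_cancel]
    by_cases hD : D ⊆ t
    · rw [if_pos hD, mul_one, prod_congr rfl fun c (hc : c ∈ univ \ t) =>
        if_neg fun hcD => (mem_sdiff.1 hc).2 (hD hcD)]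
    · rw [if_neg hD, mul_zero]
      obtain ⟨c, hcD, hct⟩ := not_subset.1 hD
      have h0 : (∏ c ∈ univ \ t, (if c ∈ D then (0 : ℝ) else p c)) = 0 :=
        prod_eq_zero (mem_sdiff.2 ⟨mem_univ _, hct⟩) (by rw [if_pos hcD])
      rw [h0, mul_zero]
  rw [← key]
  refine Fintype.sum_equiv ⟨compl, compl, compl_compl, compl_compl⟩ _ _ fun t => ?_
  show ((∏ c ∈ t, p c) * ∏ c ∈ tᶜ, (1 - p c)) * (if Disjoint D t then 1 else 0) =
    ((∏ c ∈ tᶜ, (1 - p c)) * ∏ c ∈ tᶜᶜ, (1 - (1 - p c))) * if D ⊆ tᶜ then 1 else 0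
  have hiff : D ⊆ tᶜ ↔ Disjoint D t := by
    rw [Finset.subset_iff, Finset.disjoint_left]
    simp only [mem_compl]
  rw [compl_compl, mul_comm (∏ c ∈ tᶜ, (1 - p c))]
  simp only [sub_sub_cancel]
  by_cases h : Disjoint D t
  · rw [if_pos h, if_pos (hiff.2 h)]
  · rw [if_neg h, if_neg (fun h' => h (hiff.1 h'))]

end Bernoulli

end Summit.PneNP.PneNP.Cruxes.PolyDepthTwinsAbove.ParityWiredPorts
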